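import Summits.QuantumFields.BalabanUV.Beta.GAN24.CombTransportZeroMode
import Summits.QuantumFields.BalabanUV.Beta.GAN24.CombLegSourceRuledClass
import Summits.QuantumFields.BalabanUV.Beta.GAN24.CombChargeConservationRow
import Summits.QuantumFields.BalabanUV.Beta.GAN24.T2RecChargeStep
import Summits.QuantumFields.BalabanUV.Beta.GAN24.TableDressingZeroMode

/-!
# `BalabanUV.Beta.GAN24.CombT2RecChargeStep` — binder row G-an2-4 ∕ (CONV-C), TRANSFER-III, the (III′) (C)-campaign in branch (i) of E0: **THE EXACT ONE-STEP LAW OF THE FIELD–FIELD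
# ZERO-MODE CHARGE ALONG THE COMB-CHART `T₂` TOWER** `T̃′♮_j = unitS₂_j (T2RecOf d Lc (GcombSh Lc) (SpureCombOf tabs cE cVH cΛ) tabs.M cE₂ cB Tc tabs.vh₂S tabs.mixFF j)` — the (III′) twin of
# road-P2 g36's `T2RecChargeStep` §1–§3: the comb-chart linear part reads the charge of the ROOTED-bm-DRESSED FOUR-SLOT-TRANSPORTED table `𝔇_{ρ_c} (𝒯₄ T̃′♮_j)` (leaf-01 g84's
# `CombTransportZeroMode.lin4_unitK_GcombSh_eq_fourSlot` ⨾ leaf-06's `LinT2CoDressedStep.lin4_comb_coDressKBmAt` at the centred root), so that the row (d′) of the OWNER's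
# `CombChargeConservationRow` reads, level by level, `zmodeSym_N (b̃′♮_j) = 2λ̂·[zmodeSym_Lc (T̃′♮_j) − zmodeSym_Lc (𝔇_{ρ_c} (𝒯₄ T̃′♮_j))]` (OWNER `b2b-balaban-gan24-p1`, gen 51)

NOT IN PRINT; OUR BOOKKEEPING ([folklore] composition BY NAME at weight 0; 0 `def`, 0 cited facts, 0 `def … : Prop`, 0 sorry; no existing file touched).  HONEST FRAMING (cell
contract, verbatim): «discharging `BetaPertH` makes Bałaban's UV stability UNCONDITIONAL — a real constructive-QFT result; it is NOT the continuum limit and NOT the Clay problem.»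
HONEST DEPENDENCY (verbatim): «continuum YM on T⁴ ⇐ BetaPertH ∧ nine spine estimates (0/9 proved); BetaPertH ⇐ (D1) ∧ (D4) ∧ CAP+tail; G-an2-4 gates asym, D1 and NE2/3/4.»

WHY.  Engine C's E0 verdict of record (`run/shared/lean/ttrl/balaban-calc/ccons/E0.md` 970a5b77…46fb, 2026-08-27, requests l.4432 `R-GAN24P1-51-E0`, branch (i): at (4,3) the
comb-chart tower conserves its ff zero-mode charge at level 0 → 1 ENTRYWISE by value) opens memo M-1's (III′) (C)-campaign on the OWNER's side; its §2 lists this file as the first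
mechanical twin («`T2RecChargeStep` §2 `zmode_succ_eq` (the G′-frame law with the dressing read) NOT typed»).  leaf-01 g84 supplied the transport letters the same hour
((S1) `SymCorrectorZeroMode`, (S2) `CombTransportZeroMode`); this file composes them with road-P2's (E) law.

NOTATION (docstrings only).  `Ψ̂_S := psiKS (ctrOff (d+1) Lc) Lc`, `ρ_c := toSite (ctrOff (d+1) Lc)` (`= ctr (d+1) Lc` by `rfl`), `Y_j := 𝒯₄ T̃′♮_j := (κ₁ u₁ κ₂ u₂) ↦ Ψ̂_Sᵀ ∘ slotPsiS
(slotPsiS T̃′♮_j κ₁ u₁) κ₂ u₂ ∘ Ψ̂_S`, `𝔇 X := (κ u κ′ u′) ↦ dressKBmAt ρ_c Lc (coProjBmAtK ρ_c Lc (κ₁ u₁ ↦ coProjBmAtK ρ_c Lc (X κ₁ u₁) κ′ u′) κ u)` (leaf-06's leg-and-slot dressing, the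
lambda of `lin4_comb_coDressKBmAt` VERBATIM), `K♮_j := unitK_j (KInvStep Lc j)`, `c := cE₂·Lc^{2(d+1)}`, `𝒜^B_j := lin4 c K♮_j Lc`, `b̃′♮_j` := the `T̃′`-free part of the comb step
(`CombLegSourceRuledClass.succ_combChart`), `σ′_j := T̃′♮_{j+1} − 𝒜^B_j T̃′♮_j`, `2λ̂ := N^{d+1}·c·Lc^{−4(d+2)}`.

WHAT (generic `d`, ANY sym record `tabs : SymTables d Lc`, every `j`, every period `N`, ALL constants symbolic, NO pin; the record's border with zero ff and mm blocks `hBff ∕ hBmm`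
DISPLAYED — `rfl` at an1's record):
* §1 **`succ_eq_lin4_dress_fourSlot_add`** — `T̃′♮_{j+1} = 𝒜^B_j (𝔇 Y_j) + b̃′♮_j` (road-P2's `succ_combChart` ⨾ leaf-01's `lin4_unitK_GcombSh_eq_fourSlot` ⨾ leaf-06's `lin4_comb_coDressKBmAt`
  on leaf-01's class `locStencil₂_fourSlot`).
* §2 **`zmode_succ_eq`** — THE ONE-STEP CHARGE LAW, cell form at any period `N`:
  `zmode N T̃′♮_{j+1} (μν;αβ) = zmode N b̃′♮_j (μν;αβ) + N^{d+1}·c·½·Lc^{−4(d+2)}·(zmode Lc (𝔇 Y_j)(μν;αβ) + zmode Lc (𝔇 Y_j)(νμ;αβ))` (`Lin4ZeroMode.zmode_lin4_step` on the dressed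
  transported table — `LocStencil₂` by `T2RecChargeStep.shape_dress` ∘ `locStencil₂_fourSlot`, jointly covariant by `LinT2CoDressedStep.translate_dress` ∘ leaf-01's `fourSlot_translate`);
  **`zmode_succ_eq_fourFace`** — the same in FOUR-FACE currency: `zmode Lc (𝔇 Y_j) = Lc⁴·FF_Lc (Y_j)` (leaf-02 g52's `TableDressingZeroMode.zmode_tableDress_ff`, literal
  `if … then … else 0` form); **`zmode_succ_antisymm`** — the bond-antisymmetric charge of `T̃′♮_{j+1}` is the forcing's alone (E0 by value: 0.0 at level 0).
* §3 **`zmodeSym_forcing_eq`** — `zmodeSym_N (b̃′♮_j) = zmodeSym_N (T̃′♮_{j+1}) − 2λ̂·zmodeSym_Lc (𝔇 Y_j)`; **`zmodeSym_sourceB_eq_forcing_add_defect`** — with the OWNER g50's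
  `CombChargeConservationRow.zmodeSym_sourceB_comb_eq`: `zmodeSym_N (σ′_j) = zmodeSym_N (b̃′♮_j) − 2λ̂·[zmodeSym_Lc (T̃′♮_j) − zmodeSym_Lc (𝔇 Y_j)]` — so the row (d′) at level `j`
  (`zmodeSym_Lc (σ′_j) = 0`, `CombChargeConservationRow.zsymMember_comb_succ_eq_iff_rowC`) reads «the comb forcing's symmetrised charge equals `2λ̂` times the DRESSING DEFECT of the
  transported member», the exact (E) shape (there: `𝔇 T̃_j` in place of `𝔇 Y_j`; here leaf-01's `zmode_fourSlot_comb_member_eq` lets one read `zmodeSym_Lc (T̃′♮_j)` as `zmodeSym_Lc (Y_j)`).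
WHAT THIS IS NOT.  An identity file: asserts NO value of any charge (E0's numbers — the defect is `(17 − 1)·s`-sized at level 0 at (4,3) and cancelled by the forcing — are Engine C's, by value,
zero weight); discharges NOTHING of (d′) ∕ (d″) ∕ (C) ∕ the S-slot rows; the four-face currency (`TableDressingZeroMode`) and the VALUE files are the sequel; NEVER «G-an2-4 closed» as
(CONV-C); NOT D1, NOT `BetaPertH`, NOT continuum, NOT Clay; not in print.  2026-08-27.
-/

noncomputable section

open Finset
open scoped BigOperators
open Literature.MathematicalPhysics.QuantumFieldTheory
open Literature.MathematicalPhysics.QuantumFieldTheory.Balaban1983to89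
open Literature.MathematicalPhysics.QuantumFieldTheory.Balaban1983to89.Beta
open ExpKernelCalculus (MKer Decays comp shiftK)
open OneStepResolventKernel (Fib decays_mono)
open OneStepKernelFamily (KInvStep decays_KInvStep)
open AffineAveraging (Site box toSite)
open AveragingContoursRooted (ctr ctrOff ctrOff_mem_box)
open BalabanCompositeJets (LocStencil₂)
open SecondOrderResponse (W2SymOfK)
open BalabanStepJetsSucc (mmRead)
open BalabanStepW2 (K3OfK M2Of)
open Summit.QuantumFields.BalabanUV.Beta.TameKernelCalculus (trK)
open Summit.QuantumFields.BalabanUV.Beta.HessKerDressedUnits (unitK unitS decays_unitK)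
open Summit.QuantumFields.BalabanUV.Beta.SecondOrderUnits (unitM unitS₂ unitM₂)
open Summit.QuantumFields.BalabanUV.Beta.AxialDressingRooted (coProjBmAtK coDressKBmAt dressKBmAt one_le_of_neZero)
open Summit.QuantumFields.BalabanUV.Beta.SpineRooted (T2RecOf)
open Summit.QuantumFields.BalabanUV.Beta.SymmetrisedStepJets (SymTables)
open Summit.QuantumFields.BalabanUV.Beta.CombChartStepJets (GcombSh SpureCombOf)
open Summit.QuantumFields.BalabanUV.Beta.SymCorrectorKernel (psiKS)
open Summit.QuantumFields.BalabanUV.Beta.SymCorrectorFace (slotPsiS)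
open Summit.QuantumFields.BalabanUV.Beta.GAN24.CombesThomas (sfStep smStep)
open Summit.QuantumFields.BalabanUV.Beta.GAN24.T2RecursionAffine (lin4)
open Summit.QuantumFields.BalabanUV.Beta.GAN24.BiStencilZeroMode (Tab zmode)
open Summit.QuantumFields.BalabanUV.Beta.GAN24.WSlotFirstDiff (zmode_sub)
open Summit.QuantumFields.BalabanUV.Beta.GAN24.Lin4ZeroMode (locStencil₂_lin4 zmode_lin4_step)
open Summit.QuantumFields.BalabanUV.Beta.GAN24.LinT2CoDressedStep (lin4_comb_coDressKBmAt translate_dress)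
open Summit.QuantumFields.BalabanUV.Beta.GAN24.T2RecChargeStep (shape_dress)
open Summit.QuantumFields.BalabanUV.Beta.GAN24.TableDressingZeroMode (zmode_tableDress_ff)
open Summit.QuantumFields.BalabanUV.Beta.GAN24.CombRelSourceHalfCharge (locStencil₂_unitS₂_T2RecOf_comb)
open Summit.QuantumFields.BalabanUV.Beta.GAN24.CombT2DriftEvenEnd (unitS₂_T2RecOf_comb_translate)
open Summit.QuantumFields.BalabanUV.Beta.GAN24.CombLegSourceRuledClass (succ_combChart bdd₄_source_combChart exists_locStencil₂_source_combChart)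
open Summit.QuantumFields.BalabanUV.Beta.GAN24.CombTransportZeroMode (fourSlot_translate locStencil₂_fourSlot lin4_unitK_GcombSh_eq_fourSlot zmode_fourSlot_comb_member_eq pos_of_neZero)
open Summit.QuantumFields.BalabanUV.Beta.GAN24.CombChargeConservationRow (zmodeSym_sourceB_comb_eq)

namespace Summit.QuantumFields.BalabanUV.Beta.GAN24.CombT2RecChargeStep

variable {d : ℕ} {Lc : ℕ} [NeZero Lc]

/-! ## §0 The four-slot-transported member `Y_j = 𝒯₄ T̃′♮_j` and its dressed read: class and covariance (leaf-01 g84 ⨾ leaf-06 ⨾ road-P2, by name) -/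

/-- [folklore] **`Y_j = 𝒯₄ T̃′♮_j` IS A `LocStencil₂` TABLE** (leaf-01 g84's `locStencil₂_fourSlot` on leaf-01 g80's `locStencil₂_unitS₂_T2RecOf_comb`; rate quartered). -/
theorem shape_fourSlot_member (tabs : SymTables d Lc) (cE cVH cΛ cE₂ cB : ℝ) (Tc : Fin 4 → Fin 4 → Fin 4 → Fin 4 → ℝ) (j : ℕ) :
    ∃ C δ : ℝ, 0 < δ ∧ LocStencil₂ (fun κ₁ u₁ κ₂ u₂ => comp (comp (trK (psiKS (ctrOff (d + 1) Lc) Lc)) (slotPsiS (ctrOff (d + 1) Lc) Lc (slotPsiS (ctrOff (d + 1) Lc) Lc (unitS₂ (sfStep Lc j) (smStep d Lc j) (T2RecOf d Lc (GcombSh Lc) (SpureCombOf tabs cE cVH cΛ) tabs.M cE₂ cB Tc tabs.vh₂S tabs.mixFF j)) κ₁ u₁) κ₂ u₂)) (psiKS (ctrOff (d + 1) Lc) Lc)) C δ := by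
  obtain ⟨C, δ, hδ, hT⟩ := locStencil₂_unitS₂_T2RecOf_comb tabs cE cVH cΛ cE₂ cB Tc j
  obtain ⟨C', hY⟩ := locStencil₂_fourSlot (pos_of_neZero (Lc := Lc)) (ctrOff_mem_box (pos_of_neZero (Lc := Lc))) hT hδ
  exact ⟨C', δ / 4, by positivity, hY⟩

/-- [folklore] **`Y_j` IS JOINTLY `Lc`-COVARIANT** (leaf-01 g84's `fourSlot_translate` on the OWNER g46's `unitS₂_T2RecOf_comb_translate`). -/
theorem fourSlot_member_translate (tabs : SymTables d Lc) (cE cVH cΛ cE₂ cB : ℝ) (Tc : Fin 4 → Fin 4 → Fin 4 → Fin 4 → ℝ) (j : ℕ)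
    (κ : Fin (d + 1)) (u : Fin (d + 1) → ℤ) (κ' : Fin (d + 1)) (u' t : Fin (d + 1) → ℤ) :
    (fun κ₁ u₁ κ₂ u₂ => comp (comp (trK (psiKS (ctrOff (d + 1) Lc) Lc)) (slotPsiS (ctrOff (d + 1) Lc) Lc (slotPsiS (ctrOff (d + 1) Lc) Lc (unitS₂ (sfStep Lc j) (smStep d Lc j) (T2RecOf d Lc (GcombSh Lc) (SpureCombOf tabs cE cVH cΛ) tabs.M cE₂ cB Tc tabs.vh₂S tabs.mixFF j)) κ₁ u₁) κ₂ u₂)) (psiKS (ctrOff (d + 1) Lc) Lc)) κ (u + (Lc : ℤ) • t) κ' (u' + (Lc : ℤ) • t)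
      = shiftK (-((Lc : ℤ) • t)) ((fun κ₁ u₁ κ₂ u₂ => comp (comp (trK (psiKS (ctrOff (d + 1) Lc) Lc)) (slotPsiS (ctrOff (d + 1) Lc) Lc (slotPsiS (ctrOff (d + 1) Lc) Lc (unitS₂ (sfStep Lc j) (smStep d Lc j) (T2RecOf d Lc (GcombSh Lc) (SpureCombOf tabs cE cVH cΛ) tabs.M cE₂ cB Tc tabs.vh₂S tabs.mixFF j)) κ₁ u₁) κ₂ u₂)) (psiKS (ctrOff (d + 1) Lc) Lc)) κ u κ' u') :=
  fourSlot_translate (pos_of_neZero (Lc := Lc)) (ctrOff (d + 1) Lc) (unitS₂_T2RecOf_comb_translate tabs cE cVH cΛ cE₂ cB Tc j) κ u κ' u' t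

/-! ## §1 The comb-chart affine step with the dressing moved onto the transported table -/

/-- NOT IN PRINT; OUR BOOKKEEPING.  **THE COMB-CHART AFFINE STEP, DRESSING ON THE TRANSPORTED TABLE**: for every `j`, `T̃′♮_{j+1} = 𝒜^B_j (𝔇 Y_j) + b̃′♮_j` — road-P2's
`CombLegSourceRuledClass.succ_combChart` (`T̃′♮_{j+1} = lin4 c (unitK_j G′_j) Lc T̃′♮_j + b̃′♮_j`) followed by leaf-01 g84's `lin4_unitK_GcombSh_eq_fourSlot` (`G′_j ↦ Ĝ_{ρ_c,j}` on `Y_j`)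
and leaf-06's `lin4_comb_coDressKBmAt` (`Ĝ_{ρ_c,j} ↦ K♮_j` on `𝔇 Y_j`). -/
theorem succ_eq_lin4_dress_fourSlot_add (tabs : SymTables d Lc) (cE cVH cΛ cE₂ cB : ℝ) (Tc : Fin 4 → Fin 4 → Fin 4 → Fin 4 → ℝ)
    (hBff : ∀ κ u κ' u' x z (α β : Fin (d + 1)), tabs.vh₂S κ u κ' u' x z (Sum.inl α) (Sum.inl β) = 0)
    (hBmm : ∀ κ u κ' u' x z (μ ν : Fin (d + 1)), tabs.vh₂S κ u κ' u' x z (Sum.inr μ) (Sum.inr ν) = 0) (j : ℕ) :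
    unitS₂ (sfStep Lc (j + 1)) (smStep d Lc (j + 1)) (T2RecOf d Lc (GcombSh Lc) (SpureCombOf tabs cE cVH cΛ) tabs.M cE₂ cB Tc tabs.vh₂S tabs.mixFF (j + 1))
      = lin4 (cE₂ * (Lc : ℝ) ^ (2 * (d + 1))) (unitK (sfStep Lc j) (smStep d Lc j) (KInvStep (d := d) Lc j)) Lc
          (fun κ u κ' u' => dressKBmAt (toSite (ctrOff (d + 1) Lc)) Lc (coProjBmAtK (toSite (ctrOff (d + 1) Lc)) Lc (fun κ₁ u₁ => coProjBmAtK (toSite (ctrOff (d + 1) Lc)) Lc (fun κ₂ u₂ => comp (comp (trK (psiKS (ctrOff (d + 1) Lc) Lc)) (slotPsiS (ctrOff (d + 1) Lc) Lc (slotPsiS (ctrOff (d + 1) Lc) Lc (unitS₂ (sfStep Lc j) (smStep d Lc j) (T2RecOf d Lc (GcombSh Lc) (SpureCombOf tabs cE cVH cΛ) tabs.M cE₂ cB Tc tabs.vh₂S tabs.mixFF j)) κ₁ u₁) κ₂ u₂)) (psiKS (ctrOff (d + 1) Lc) Lc)) κ' u') κ u))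
        + (fun κ u κ' u' => (cE₂ * (Lc : ℝ) ^ (2 * (d + 1))) • mmRead Lc (K3OfK (unitK (sfStep Lc j) (smStep d Lc j) (GcombSh (d := d) Lc j)) Lc (unitS (sfStep Lc j) (smStep d Lc j) (SpureCombOf tabs cE cVH cΛ j)) (unitM (sfStep Lc j) (smStep d Lc j) (tabs.M j)) (W2SymOfK (unitK (sfStep Lc j) (smStep d Lc j) (GcombSh (d := d) Lc j)) Lc (unitS (sfStep Lc j) (smStep d Lc j) (SpureCombOf tabs cE cVH cΛ j)) (unitM (sfStep Lc j) (smStep d Lc j) (tabs.M j)) 0 (unitM₂ (sfStep Lc j) (smStep d Lc j) (M2Of d Lc tabs.mixFF j))) κ u κ' u') + cB • tabs.vh₂S κ u κ' u') := by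
  obtain ⟨CT, δT, hδT, hT⟩ := locStencil₂_unitS₂_T2RecOf_comb tabs cE cVH cΛ cE₂ cB Tc j
  obtain ⟨CY, δY, hδY, hY⟩ := shape_fourSlot_member tabs cE cVH cΛ cE₂ cB Tc j
  rw [succ_combChart tabs cE cVH cΛ cE₂ cB Tc hBff hBmm j]
  congr 1
  have e4 : lin4 (cE₂ * (Lc : ℝ) ^ (2 * (d + 1))) (unitK (sfStep Lc j) (smStep d Lc j) (GcombSh (d := d) Lc j)) Lc (unitS₂ (sfStep Lc j) (smStep d Lc j) (T2RecOf d Lc (GcombSh Lc) (SpureCombOf tabs cE cVH cΛ) tabs.M cE₂ cB Tc tabs.vh₂S tabs.mixFF j))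
      = lin4 (cE₂ * (Lc : ℝ) ^ (2 * (d + 1))) (unitK (sfStep Lc j) (smStep d Lc j) (coDressKBmAt (toSite (ctrOff (d + 1) Lc)) Lc (KInvStep (d := d) Lc j))) Lc
          (fun κ₁ u₁ κ₂ u₂ => comp (comp (trK (psiKS (ctrOff (d + 1) Lc) Lc)) (slotPsiS (ctrOff (d + 1) Lc) Lc (slotPsiS (ctrOff (d + 1) Lc) Lc (unitS₂ (sfStep Lc j) (smStep d Lc j) (T2RecOf d Lc (GcombSh Lc) (SpureCombOf tabs cE cVH cΛ) tabs.M cE₂ cB Tc tabs.vh₂S tabs.mixFF j)) κ₁ u₁) κ₂ u₂)) (psiKS (ctrOff (d + 1) Lc) Lc)) := by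
    funext κ u κ' u'
    exact lin4_unitK_GcombSh_eq_fourSlot j (cE₂ * (Lc : ℝ) ^ (2 * (d + 1))) hT hδT κ u κ' u'
  rw [e4, lin4_comb_coDressKBmAt (ctrOff_mem_box (pos_of_neZero (Lc := Lc))) j hY hδY]

/-! ## §2 THE ONE-STEP CHARGE LAW: the comb-chart linear part reads the charge of the dressed transported table -/

/-- NOT IN PRINT; OUR BOOKKEEPING ([folklore] composition).  **THE ONE-STEP CHARGE LAW OF THE COMB-CHART TOWER**, cell form at any period `N`:
`zmode N T̃′♮_{j+1} (μ,ν;α,β) = zmode N b̃′♮_j (μ,ν;α,β) + N^{d+1}·(cE₂·Lc^{2(d+1)})·½·Lc^{−4(d+2)}·(zmode Lc (𝔇 Y_j) (μ,ν;α,β) + zmode Lc (𝔇 Y_j) (ν,μ;α,β))` — §1 + leaf-18's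
`Lin4ZeroMode.zmode_lin4_step` on the dressed transported table (class `T2RecChargeStep.shape_dress` ∘ §0, covariance `LinT2CoDressedStep.translate_dress` ∘ §0) + `zmode_sub`.  The (III′)
twin of road-P2 g36's `T2RecChargeStep.zmode_succ_eq`; every `j`, generic `d`, all constants symbolic, NO pin. -/
theorem zmode_succ_eq (tabs : SymTables d Lc) (cE cVH cΛ cE₂ cB : ℝ) (Tc : Fin 4 → Fin 4 → Fin 4 → Fin 4 → ℝ)
    (hBff : ∀ κ u κ' u' x z (α β : Fin (d + 1)), tabs.vh₂S κ u κ' u' x z (Sum.inl α) (Sum.inl β) = 0)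
    (hBmm : ∀ κ u κ' u' x z (μ ν : Fin (d + 1)), tabs.vh₂S κ u κ' u' x z (Sum.inr μ) (Sum.inr ν) = 0) (N j : ℕ) (μ ν α β : Fin (d + 1)) :
    zmode N (unitS₂ (sfStep Lc (j + 1)) (smStep d Lc (j + 1)) (T2RecOf d Lc (GcombSh Lc) (SpureCombOf tabs cE cVH cΛ) tabs.M cE₂ cB Tc tabs.vh₂S tabs.mixFF (j + 1))) μ ν (Sum.inl α) (Sum.inl β)
      = zmode N (fun κ u κ' u' => (cE₂ * (Lc : ℝ) ^ (2 * (d + 1))) • mmRead Lc (K3OfK (unitK (sfStep Lc j) (smStep d Lc j) (GcombSh (d := d) Lc j)) Lc (unitS (sfStep Lc j) (smStep d Lc j) (SpureCombOf tabs cE cVH cΛ j)) (unitM (sfStep Lc j) (smStep d Lc j) (tabs.M j)) (W2SymOfK (unitK (sfStep Lc j) (smStep d Lc j) (GcombSh (d := d) Lc j)) Lc (unitS (sfStep Lc j) (smStep d Lc j) (SpureCombOf tabs cE cVH cΛ j)) (unitM (sfStep Lc j) (smStep d Lc j) (tabs.M j)) 0 (unitM₂ (sfStep Lc j) (smStep d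 Lc j) (M2Of d Lc tabs.mixFF j))) κ u κ' u') + cB • tabs.vh₂S κ u κ' u') μ ν (Sum.inl α) (Sum.inl β)
        + ((N : ℝ) ^ (d + 1)) * ((cE₂ * (Lc : ℝ) ^ (2 * (d + 1))) * ((1 / 2 : ℝ) * (((Lc : ℝ) ^ (d + 1 + 1))⁻¹) ^ 4) *
          (zmode Lc (fun κ u κ' u' => dressKBmAt (toSite (ctrOff (d + 1) Lc)) Lc (coProjBmAtK (toSite (ctrOff (d + 1) Lc)) Lc (fun κ₁ u₁ => coProjBmAtK (toSite (ctrOff (d + 1) Lc)) Lc (fun κ₂ u₂ => comp (comp (trK (psiKS (ctrOff (d + 1) Lc) Lc)) (slotPsiS (ctrOff (d + 1) Lc) Lc (slotPsiS (ctrOff (d + 1) Lc) Lc (unitS₂ (sfStep Lc j) (smStep d Lc j) (T2RecOf d Lc (GcombSh Lc) (SpureCombOf tabs cE cVH cΛ) tabs.M cE₂ cB Tc tabs.vh₂S tabs.mixFF j)) κ₁ u₁) κ₂ u₂)) (psiKS (ctrOff (d + 1) Lc) Lc)) κ' u') κ u)) μ ν (Sum.inl α) (Sum.inl β)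
            + zmode Lc (fun κ u κ' u' => dressKBmAt (toSite (ctrOff (d + 1) Lc)) Lc (coProjBmAtK (toSite (ctrOff (d + 1) Lc)) Lc (fun κ₁ u₁ => coProjBmAtK (toSite (ctrOff (d + 1) Lc)) Lc (fun κ₂ u₂ => comp (comp (trK (psiKS (ctrOff (d + 1) Lc) Lc)) (slotPsiS (ctrOff (d + 1) Lc) Lc (slotPsiS (ctrOff (d + 1) Lc) Lc (unitS₂ (sfStep Lc j) (smStep d Lc j) (T2RecOf d Lc (GcombSh Lc) (SpureCombOf tabs cE cVH cΛ) tabs.M cE₂ cB Tc tabs.vh₂S tabs.mixFF j)) κ₁ u₁) κ₂ u₂)) (psiKS (ctrOff (d + 1) Lc) Lc)) κ' u') κ u)) ν μ (Sum.inl α) (Sum.inl β))) := by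
  have hLc : 1 ≤ Lc := one_le_of_neZero Lc
  have hr := ctrOff_mem_box (d := d + 1) hLc
  have hstep := succ_eq_lin4_dress_fourSlot_add tabs cE cVH cΛ cE₂ cB Tc hBff hBmm j
  obtain ⟨C1, δ1, hδ1, hT1⟩ := locStencil₂_unitS₂_T2RecOf_comb tabs cE cVH cΛ cE₂ cB Tc (j + 1)
  obtain ⟨CY, δY, hδY, hY⟩ := shape_fourSlot_member tabs cE cVH cΛ cE₂ cB Tc j
  have hYcov := fourSlot_member_translate tabs cE cVH cΛ cE₂ cB Tc j
  obtain ⟨CD, hD⟩ := shape_dress (X := (fun κ₁ u₁ κ₂ u₂ => comp (comp (trK (psiKS (ctrOff (d + 1) Lc) Lc)) (slotPsiS (ctrOff (d + 1) Lc) Lc (slotPsiS (ctrOff (d + 1) Lc) Lc (unitS₂ (sfStep Lc j) (smStep d Lc j) (T2RecOf d Lc (GcombSh Lc) (SpureCombOf tabs cE cVH cΛ) tabs.M cE₂ cB Tc tabs.vh₂S tabs.mixFF j)) κ₁ u₁) κ₂ u₂)) (psiKS (ctrOff (d + 1) Lc) Lc))) hLc hr hY hδY.le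
  have hDcov := translate_dress (X := (fun κ₁ u₁ κ₂ u₂ => comp (comp (trK (psiKS (ctrOff (d + 1) Lc) Lc)) (slotPsiS (ctrOff (d + 1) Lc) Lc (slotPsiS (ctrOff (d + 1) Lc) Lc (unitS₂ (sfStep Lc j) (smStep d Lc j) (T2RecOf d Lc (GcombSh Lc) (SpureCombOf tabs cE cVH cΛ) tabs.M cE₂ cB Tc tabs.vh₂S tabs.mixFF j)) κ₁ u₁) κ₂ u₂)) (psiKS (ctrOff (d + 1) Lc) Lc))) (toSite (ctrOff (d + 1) Lc)) hLc hYcov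
  obtain ⟨m, CK, hm, hCK, hK⟩ := decays_KInvStep (d := d) (Lc := Lc) j
  have hA := locStencil₂_lin4 (decays_unitK (sf := sfStep Lc j) (sm := smStep d Lc j) hK) (by positivity) hm hLc
    (cE₂ * (Lc : ℝ) ^ (2 * (d + 1))) hD hδY
  have hz := zmode_lin4_step hLc N j (cE₂ * (Lc : ℝ) ^ (2 * (d + 1))) hD hδY hDcov μ ν α β
  have hb : (fun κ u κ' u' => (cE₂ * (Lc : ℝ) ^ (2 * (d + 1))) • mmRead Lc (K3OfK (unitK (sfStep Lc j) (smStep d Lc j) (GcombSh (d := d) Lc j)) Lc (unitS (sfStep Lc j) (smStep d Lc j) (SpureCombOf tabs cE cVH cΛ j)) (unitM (sfStep Lc j) (smStep d Lc j) (tabs.M j)) (W2SymOfK (unitK (sfStep Lc j) (smStep d Lc j) (GcombSh (d := d) Lc j)) Lc (unitS (sfStep Lc j) (smStep d Lc j) (SpureCombOf tabs cE cVH cΛ j)) (unitM (sfStep Lc j) (smStep d Lc j) (tabs.M j)) 0 (unitM₂ (sfStep Lc j) (smStep d Lc j) (M2Of d Lc tabs.mixFF j))) κ u κ' u') + cB •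 tabs.vh₂S κ u κ' u')
      = fun κ u κ' u' =>
          unitS₂ (sfStep Lc (j + 1)) (smStep d Lc (j + 1)) (T2RecOf d Lc (GcombSh Lc) (SpureCombOf tabs cE cVH cΛ) tabs.M cE₂ cB Tc tabs.vh₂S tabs.mixFF (j + 1)) κ u κ' u'
        - lin4 (cE₂ * (Lc : ℝ) ^ (2 * (d + 1))) (unitK (sfStep Lc j) (smStep d Lc j) (KInvStep (d := d) Lc j)) Lc
            (fun κ u κ' u' => dressKBmAt (toSite (ctrOff (d + 1) Lc)) Lc (coProjBmAtK (toSite (ctrOff (d + 1) Lc)) Lc (fun κ₁ u₁ => coProjBmAtK (toSite (ctrOff (d + 1) Lc)) Lc (fun κ₂ u₂ => comp (comp (trK (psiKS (ctrOff (d + 1) Lc) Lc)) (slotPsiS (ctrOff (d + 1) Lc) Lc (slotPsiS (ctrOff (d + 1) Lc) Lc (unitS₂ (sfStep Lc j) (smStep d Lc j) (T2RecOf d Lc (GcombSh Lc) (SpureCombOf tabs cE cVH cΛ) tabs.M cE₂ cB Tc tabs.vh₂S tabs.mixFF j)) κ₁ u₁) κ₂ u₂)) (psiKS (ctrOff (d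 + 1) Lc) Lc)) κ' u') κ u))
            κ u κ' u' := by
    rw [hstep]
    funext κ u κ' u'
    simp only [Pi.add_apply, add_sub_cancel_left]
  have hr0 : 0 < min δ1 (min m δY / 128) := lt_min hδ1 (by positivity)
  rw [hb, zmode_sub (N := N) (hT1.mono (min_le_left _ _)) (hA.mono (min_le_right _ _)) hr0, hz]
  ring

/-- NOT IN PRINT; OUR BOOKKEEPING.  **THE ONE-STEP CHARGE LAW IN FOUR-FACE CURRENCY**: §2 with leaf-02 g52's `zmode_tableDress_ff` (`zmode_Lc (𝔇 Y) = Lc⁴·FF_Lc (Y)`, the four EXIT-FACE read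
at period `Lc`, literal `if … then … else 0` form) on `Y_j = 𝒯₄ T̃′♮_j` — the (III′) twin of road-P2's `T2RecChargeStepFourFace.zmode_succ_eq_fourFace`.  At level 0 at (4,3) Engine C's E0 reads
this line as «linear part = 17·s, forcing = −16·s» (by value, zero weight). -/
theorem zmode_succ_eq_fourFace (tabs : SymTables d Lc) (cE cVH cΛ cE₂ cB : ℝ) (Tc : Fin 4 → Fin 4 → Fin 4 → Fin 4 → ℝ)
    (hBff : ∀ κ u κ' u' x z (α β : Fin (d + 1)), tabs.vh₂S κ u κ' u' x z (Sum.inl α) (Sum.inl β) = 0)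
    (hBmm : ∀ κ u κ' u' x z (μ ν : Fin (d + 1)), tabs.vh₂S κ u κ' u' x z (Sum.inr μ) (Sum.inr ν) = 0) (N j : ℕ) (μ ν α β : Fin (d + 1)) :
    zmode N (unitS₂ (sfStep Lc (j + 1)) (smStep d Lc (j + 1)) (T2RecOf d Lc (GcombSh Lc) (SpureCombOf tabs cE cVH cΛ) tabs.M cE₂ cB Tc tabs.vh₂S tabs.mixFF (j + 1))) μ ν (Sum.inl α) (Sum.inl β)
      = zmode N (fun κ u κ' u' => (cE₂ * (Lc : ℝ) ^ (2 * (d + 1))) • mmRead Lc (K3OfK (unitK (sfStep Lc j) (smStep d Lc j) (GcombSh (d := d) Lc j)) Lc (unitS (sfStep Lc j) (smStep d Lc j) (SpureCombOf tabs cE cVH cΛ j)) (unitM (sfStep Lc j) (smStep d Lc j) (tabs.M j)) (W2SymOfK (unitK (sfStep Lc j) (smStep d Lc j) (GcombSh (d := d) Lc j)) Lc (unitS (sfStep Lc j) (smStep d Lc j) (SpureCombOf tabs cE cVH cΛ j)) (unitM (sfStep Lc j) (smStep d Lc j) (tabs.M j)) 0 (unitM₂ (sfStep Lc j) (smStep d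 Lc j) (M2Of d Lc tabs.mixFF j))) κ u κ' u') + cB • tabs.vh₂S κ u κ' u') μ ν (Sum.inl α) (Sum.inl β)
        + ((N : ℝ) ^ (d + 1)) * ((cE₂ * (Lc : ℝ) ^ (2 * (d + 1))) * ((1 / 2 : ℝ) * (((Lc : ℝ) ^ (d + 1 + 1))⁻¹) ^ 4) *
          (((Lc : ℝ) ^ 4 * ∑ r' ∈ box (d + 1) Lc, ∑' u' : Site (d + 1), ∑' x : Site (d + 1), ∑' z : Site (d + 1),
              (if toSite r' μ % (Lc : ℤ) = (Lc : ℤ) - 1 ∧ u' ν % (Lc : ℤ) = (Lc : ℤ) - 1 ∧ x α % (Lc : ℤ) = (Lc : ℤ) - 1 ∧ z β % (Lc : ℤ) = (Lc : ℤ) - 1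
                then comp (comp (trK (psiKS (ctrOff (d + 1) Lc) Lc)) (slotPsiS (ctrOff (d + 1) Lc) Lc (slotPsiS (ctrOff (d + 1) Lc) Lc (unitS₂ (sfStep Lc j) (smStep d Lc j) (T2RecOf d Lc (GcombSh Lc) (SpureCombOf tabs cE cVH cΛ) tabs.M cE₂ cB Tc tabs.vh₂S tabs.mixFF j)) μ (toSite r')) ν u')) (psiKS (ctrOff (d + 1) Lc) Lc) x z (Sum.inl α) (Sum.inl β) else 0))
            + ((Lc : ℝ) ^ 4 * ∑ r' ∈ box (d + 1) Lc, ∑' u' : Site (d + 1), ∑' x : Site (d + 1), ∑' z : Site (d + 1),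
              (if toSite r' ν % (Lc : ℤ) = (Lc : ℤ) - 1 ∧ u' μ % (Lc : ℤ) = (Lc : ℤ) - 1 ∧ x α % (Lc : ℤ) = (Lc : ℤ) - 1 ∧ z β % (Lc : ℤ) = (Lc : ℤ) - 1
                then comp (comp (trK (psiKS (ctrOff (d + 1) Lc) Lc)) (slotPsiS (ctrOff (d + 1) Lc) Lc (slotPsiS (ctrOff (d + 1) Lc) Lc (unitS₂ (sfStep Lc j) (smStep d Lc j) (T2RecOf d Lc (GcombSh Lc) (SpureCombOf tabs cE cVH cΛ) tabs.M cE₂ cB Tc tabs.vh₂S tabs.mixFF j)) ν (toSite r')) μ u')) (psiKS (ctrOff (d + 1) Lc) Lc) x z (Sum.inl α) (Sum.inl β) else 0)))) := by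
  have hLc : 1 ≤ Lc := one_le_of_neZero Lc
  have hr := ctrOff_mem_box (d := d + 1) hLc
  obtain ⟨CY, δY, hδY, hY⟩ := shape_fourSlot_member tabs cE cVH cΛ cE₂ cB Tc j
  have hYcov := fourSlot_member_translate tabs cE cVH cΛ cE₂ cB Tc j
  rw [zmode_succ_eq tabs cE cVH cΛ cE₂ cB Tc hBff hBmm N j μ ν α β, zmode_tableDress_ff hLc hr hY hδY hYcov μ ν α β,
    zmode_tableDress_ff hLc hr hY hδY hYcov ν μ α β]

/-- NOT IN PRINT; OUR BOOKKEEPING.  **THE BOND-ANTISYMMETRIC CHARGE OF `T̃′♮_{j+1}` IS THE FORCING's ALONE** (the transported term of §2 is bond-symmetrised; whatever `cE₂`, NO pin;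
Engine C's E0 by value at (4,3), level 0: both sides 0.0). -/
theorem zmode_succ_antisymm (tabs : SymTables d Lc) (cE cVH cΛ cE₂ cB : ℝ) (Tc : Fin 4 → Fin 4 → Fin 4 → Fin 4 → ℝ)
    (hBff : ∀ κ u κ' u' x z (α β : Fin (d + 1)), tabs.vh₂S κ u κ' u' x z (Sum.inl α) (Sum.inl β) = 0)
    (hBmm : ∀ κ u κ' u' x z (μ ν : Fin (d + 1)), tabs.vh₂S κ u κ' u' x z (Sum.inr μ) (Sum.inr ν) = 0) (N j : ℕ) (μ ν α β : Fin (d + 1)) :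
    zmode N (unitS₂ (sfStep Lc (j + 1)) (smStep d Lc (j + 1)) (T2RecOf d Lc (GcombSh Lc) (SpureCombOf tabs cE cVH cΛ) tabs.M cE₂ cB Tc tabs.vh₂S tabs.mixFF (j + 1))) μ ν (Sum.inl α) (Sum.inl β)
        - zmode N (unitS₂ (sfStep Lc (j + 1)) (smStep d Lc (j + 1)) (T2RecOf d Lc (GcombSh Lc) (SpureCombOf tabs cE cVH cΛ) tabs.M cE₂ cB Tc tabs.vh₂S tabs.mixFF (j + 1))) ν μ (Sum.inl α) (Sum.inl β)
      = zmode N (fun κ u κ' u' => (cE₂ * (Lc : ℝ) ^ (2 * (d + 1))) • mmRead Lc (K3OfK (unitK (sfStep Lc j) (smStep d Lc j) (GcombSh (d := d) Lc j)) Lc (unitS (sfStep Lc j) (smStep d Lc j) (SpureCombOf tabs cE cVH cΛ j)) (unitM (sfStep Lc j) (smStep d Lc j) (tabs.M j)) (W2SymOfK (unitK (sfStep Lc j) (smStep d Lc j) (GcombSh (d := d) Lc j)) Lc (unitS (sfStep Lc j) (smStep d Lc j) (SpureCombOf tabs cE cVH cΛ j)) (unitM (sfStep Lc j) (smStep d Lc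 j) (tabs.M j)) 0 (unitM₂ (sfStep Lc j) (smStep d Lc j) (M2Of d Lc tabs.mixFF j))) κ u κ' u') + cB • tabs.vh₂S κ u κ' u') μ ν (Sum.inl α) (Sum.inl β)
        - zmode N (fun κ u κ' u' => (cE₂ * (Lc : ℝ) ^ (2 * (d + 1))) • mmRead Lc (K3OfK (unitK (sfStep Lc j) (smStep d Lc j) (GcombSh (d := d) Lc j)) Lc (unitS (sfStep Lc j) (smStep d Lc j) (SpureCombOf tabs cE cVH cΛ j)) (unitM (sfStep Lc j) (smStep d Lc j) (tabs.M j)) (W2SymOfK (unitK (sfStep Lc j) (smStep d Lc j) (GcombSh (d := d) Lc j)) Lc (unitS (sfStep Lc j) (smStep d Lc j) (SpureCombOf tabs cE cVH cΛ j)) (unitM (sfStep Lc j) (smStep d Lc j) (tabs.M j)) 0 (unitM₂ (sfStep Lc j) (smStep d Lc j) (M2Of d Lc tabs.mixFF j))) κ u κ' u') + cB • tabs.vh₂S κ u κ' u') ν μ (Sum.inl α) (Sum.inl β) := by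
  rw [zmode_succ_eq tabs cE cVH cΛ cE₂ cB Tc hBff hBmm N j μ ν α β, zmode_succ_eq tabs cE cVH cΛ cE₂ cB Tc hBff hBmm N j ν μ α β]
  ring

/-! ## §3 The forcing's symmetrised charge and the B-frame source: (d′) ⟺ «forcing charge = 2λ̂ × the dressing defect of the transported member» -/

/-- NOT IN PRINT; OUR BOOKKEEPING.  **THE BOND-SYMMETRISED CHARGE OF THE COMB FORCING** (§2 at the two bond orders, added):
`zmodeSym_N (b̃′♮_j) = zmodeSym_N (T̃′♮_{j+1}) − N^{d+1}·c·Lc^{−4(d+2)}·zmodeSym_Lc (𝔇 Y_j)`. -/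
theorem zmodeSym_forcing_eq (tabs : SymTables d Lc) (cE cVH cΛ cE₂ cB : ℝ) (Tc : Fin 4 → Fin 4 → Fin 4 → Fin 4 → ℝ)
    (hBff : ∀ κ u κ' u' x z (α β : Fin (d + 1)), tabs.vh₂S κ u κ' u' x z (Sum.inl α) (Sum.inl β) = 0)
    (hBmm : ∀ κ u κ' u' x z (μ ν : Fin (d + 1)), tabs.vh₂S κ u κ' u' x z (Sum.inr μ) (Sum.inr ν) = 0) (N j : ℕ) (α β : Fin (d + 1)) (μ ν : Fin (d + 1)) :
    (zmode N (fun κ u κ' u' => (cE₂ * (Lc : ℝ) ^ (2 * (d + 1))) • mmRead Lc (K3OfK (unitK (sfStep Lc j) (smStep d Lc j) (GcombSh (d := d) Lc j)) Lc (unitS (sfStep Lc j) (smStep d Lc j) (SpureCombOf tabs cE cVH cΛ j)) (unitM (sfStep Lc j) (smStep d Lc j) (tabs.M j)) (W2SymOfK (unitK (sfStep Lc j) (smStep d Lc j) (GcombSh (d := d) Lc j)) Lc (unitS (sfStep Lc j) (smStep d Lc j) (SpureCombOf tabs cE cVH cΛ j)) (unitM (sfStep Lc j) (smStep d Lc j)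 (tabs.M j)) 0 (unitM₂ (sfStep Lc j) (smStep d Lc j) (M2Of d Lc tabs.mixFF j))) κ u κ' u') + cB • tabs.vh₂S κ u κ' u') μ ν (Sum.inl α) (Sum.inl β)
        + zmode N (fun κ u κ' u' => (cE₂ * (Lc : ℝ) ^ (2 * (d + 1))) • mmRead Lc (K3OfK (unitK (sfStep Lc j) (smStep d Lc j) (GcombSh (d := d) Lc j)) Lc (unitS (sfStep Lc j) (smStep d Lc j) (SpureCombOf tabs cE cVH cΛ j)) (unitM (sfStep Lc j) (smStep d Lc j) (tabs.M j)) (W2SymOfK (unitK (sfStep Lc j) (smStep d Lc j) (GcombSh (d := d) Lc j)) Lc (unitS (sfStep Lc j) (smStep d Lc j) (SpureCombOf tabs cE cVH cΛ j)) (unitM (sfStep Lc j) (smStep d Lc j) (tabs.M j)) 0 (unitM₂ (sfStep Lc j) (smStep d Lc j) (M2Of d Lc tabs.mixFF j))) κ u κ' u') + cB • tabs.vh₂S κ u κ' u') ν μ (Sum.inl α) (Sum.inl β))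
      = (zmode N (unitS₂ (sfStep Lc (j + 1)) (smStep d Lc (j + 1)) (T2RecOf d Lc (GcombSh Lc) (SpureCombOf tabs cE cVH cΛ) tabs.M cE₂ cB Tc tabs.vh₂S tabs.mixFF (j + 1))) μ ν (Sum.inl α) (Sum.inl β)
        + zmode N (unitS₂ (sfStep Lc (j + 1)) (smStep d Lc (j + 1)) (T2RecOf d Lc (GcombSh Lc) (SpureCombOf tabs cE cVH cΛ) tabs.M cE₂ cB Tc tabs.vh₂S tabs.mixFF (j + 1))) ν μ (Sum.inl α) (Sum.inl β))
        - ((N : ℝ) ^ (d + 1)) * ((cE₂ * (Lc : ℝ) ^ (2 * (d + 1))) * (((Lc : ℝ) ^ (d + 1 + 1))⁻¹) ^ 4) *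
          (zmode Lc (fun κ u κ' u' => dressKBmAt (toSite (ctrOff (d + 1) Lc)) Lc (coProjBmAtK (toSite (ctrOff (d + 1) Lc)) Lc (fun κ₁ u₁ => coProjBmAtK (toSite (ctrOff (d + 1) Lc)) Lc (fun κ₂ u₂ => comp (comp (trK (psiKS (ctrOff (d + 1) Lc) Lc)) (slotPsiS (ctrOff (d + 1) Lc) Lc (slotPsiS (ctrOff (d + 1) Lc) Lc (unitS₂ (sfStep Lc j) (smStep d Lc j) (T2RecOf d Lc (GcombSh Lc) (SpureCombOf tabs cE cVH cΛ) tabs.M cE₂ cB Tc tabs.vh₂S tabs.mixFF j)) κ₁ u₁) κ₂ u₂)) (psiKS (ctrOff (d + 1) Lc) Lc)) κ' u') κ u)) μ ν (Sum.inl α) (Sum.inl β)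
        + zmode Lc (fun κ u κ' u' => dressKBmAt (toSite (ctrOff (d + 1) Lc)) Lc (coProjBmAtK (toSite (ctrOff (d + 1) Lc)) Lc (fun κ₁ u₁ => coProjBmAtK (toSite (ctrOff (d + 1) Lc)) Lc (fun κ₂ u₂ => comp (comp (trK (psiKS (ctrOff (d + 1) Lc) Lc)) (slotPsiS (ctrOff (d + 1) Lc) Lc (slotPsiS (ctrOff (d + 1) Lc) Lc (unitS₂ (sfStep Lc j) (smStep d Lc j) (T2RecOf d Lc (GcombSh Lc) (SpureCombOf tabs cE cVH cΛ) tabs.M cE₂ cB Tc tabs.vh₂S tabs.mixFF j)) κ₁ u₁) κ₂ u₂)) (psiKS (ctrOff (d + 1) Lc) Lc)) κ' u') κ u)) ν μ (Sum.inl α) (Sum.inl β)) := by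
  rw [zmode_succ_eq tabs cE cVH cΛ cE₂ cB Tc hBff hBmm N j μ ν α β, zmode_succ_eq tabs cE cVH cΛ cE₂ cB Tc hBff hBmm N j ν μ α β]
  ring

/-- NOT IN PRINT; OUR BOOKKEEPING.  **THE B-FRAME SOURCE's SYMMETRISED CHARGE = THE FORCING's + `2λ̂` × THE DRESSING DEFECT OF THE TRANSPORTED MEMBER** (§3 with the OWNER g50's
`CombChargeConservationRow.zmodeSym_sourceB_comb_eq`): `zmodeSym_N (σ′_j) = zmodeSym_N (b̃′♮_j) − N^{d+1}·c·Lc^{−4(d+2)}·[zmodeSym_Lc (T̃′♮_j) − zmodeSym_Lc (𝔇 Y_j)]`.  Hence the row (d′) at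
level `j` (`zmodeSym_Lc (σ′_j) = 0` at the pin, `CombChargeConservationRow.zsymMember_comb_succ_eq_iff_rowC`) says EXACTLY: «the comb forcing's symmetrised charge is `2λ̂` times the
dressing defect `zmodeSym_Lc (T̃′♮_j) − zmodeSym_Lc (𝔇 Y_j)` of the transported member» — the (E) shape (road-P2 g36 §3), with leaf-01 g84's `zmode_fourSlot_comb_member_eq`
(`zmodeSym_Lc (Y_j) = zmodeSym_Lc (T̃′♮_j)`) available to read the defect on `Y_j` alone.  NO value asserted. -/
theorem zmodeSym_sourceB_eq_forcing_sub_defect (tabs : SymTables d Lc) (cE cVH cΛ cE₂ cB : ℝ) (Tc : Fin 4 → Fin 4 → Fin 4 → Fin 4 → ℝ)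
    (hBff : ∀ κ u κ' u' x z (α β : Fin (d + 1)), tabs.vh₂S κ u κ' u' x z (Sum.inl α) (Sum.inl β) = 0)
    (hBmm : ∀ κ u κ' u' x z (μ ν : Fin (d + 1)), tabs.vh₂S κ u κ' u' x z (Sum.inr μ) (Sum.inr ν) = 0) (N j : ℕ) (α β : Fin (d + 1)) (μ ν : Fin (d + 1)) :
    (zmode N (fun κ u κ' u' =>
          unitS₂ (sfStep Lc (j + 1)) (smStep d Lc (j + 1)) (T2RecOf d Lc (GcombSh Lc) (SpureCombOf tabs cE cVH cΛ) tabs.M cE₂ cB Tc tabs.vh₂S tabs.mixFF (j + 1)) κ u κ' u'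
        - lin4 (cE₂ * (Lc : ℝ) ^ (2 * (d + 1))) (unitK (sfStep Lc j) (smStep d Lc j) (KInvStep (d := d) Lc j)) Lc
            (unitS₂ (sfStep Lc j) (smStep d Lc j) (T2RecOf d Lc (GcombSh Lc) (SpureCombOf tabs cE cVH cΛ) tabs.M cE₂ cB Tc tabs.vh₂S tabs.mixFF j)) κ u κ' u') μ ν (Sum.inl α) (Sum.inl β)
        + zmode N (fun κ u κ' u' =>
          unitS₂ (sfStep Lc (j + 1)) (smStep d Lc (j + 1)) (T2RecOf d Lc (GcombSh Lc) (SpureCombOf tabs cE cVH cΛ) tabs.M cE₂ cB Tc tabs.vh₂S tabs.mixFF (j + 1)) κ u κ' u'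
        - lin4 (cE₂ * (Lc : ℝ) ^ (2 * (d + 1))) (unitK (sfStep Lc j) (smStep d Lc j) (KInvStep (d := d) Lc j)) Lc
            (unitS₂ (sfStep Lc j) (smStep d Lc j) (T2RecOf d Lc (GcombSh Lc) (SpureCombOf tabs cE cVH cΛ) tabs.M cE₂ cB Tc tabs.vh₂S tabs.mixFF j)) κ u κ' u') ν μ (Sum.inl α) (Sum.inl β))
      = (zmode N (fun κ u κ' u' => (cE₂ * (Lc : ℝ) ^ (2 * (d + 1))) • mmRead Lc (K3OfK (unitK (sfStep Lc j) (smStep d Lc j) (GcombSh (d := d) Lc j)) Lc (unitS (sfStep Lc j) (smStep d Lc j) (SpureCombOf tabs cE cVH cΛ j)) (unitM (sfStep Lc j) (smStep d Lc j) (tabs.M j)) (W2SymOfK (unitK (sfStep Lc j) (smStep d Lc j) (GcombSh (d := d) Lc j)) Lc (unitS (sfStep Lc j) (smStep d Lc j) (SpureCombOf tabs cE cVH cΛ j)) (unitM (sfStep Lc j) (smStep d Lc j) (tabs.M j)) 0 (unitM₂ (sfStep Lc j) (smStep d Lc j) (M2Of d Lc tabs.mixFF j))) κ u κ' u') + cB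 • tabs.vh₂S κ u κ' u') μ ν (Sum.inl α) (Sum.inl β)
        + zmode N (fun κ u κ' u' => (cE₂ * (Lc : ℝ) ^ (2 * (d + 1))) • mmRead Lc (K3OfK (unitK (sfStep Lc j) (smStep d Lc j) (GcombSh (d := d) Lc j)) Lc (unitS (sfStep Lc j) (smStep d Lc j) (SpureCombOf tabs cE cVH cΛ j)) (unitM (sfStep Lc j) (smStep d Lc j) (tabs.M j)) (W2SymOfK (unitK (sfStep Lc j) (smStep d Lc j) (GcombSh (d := d) Lc j)) Lc (unitS (sfStep Lc j) (smStep d Lc j) (SpureCombOf tabs cE cVH cΛ j)) (unitM (sfStep Lc j) (smStep d Lc j) (tabs.M j)) 0 (unitM₂ (sfStep Lc j) (smStep d Lc j) (M2Of d Lc tabs.mixFF j))) κ u κ' u') + cB • tabs.vh₂S κ u κ' u') ν μ (Sum.inl α) (Sum.inl β))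
        - ((N : ℝ) ^ (d + 1)) * ((cE₂ * (Lc : ℝ) ^ (2 * (d + 1))) * (((Lc : ℝ) ^ (d + 1 + 1))⁻¹) ^ 4) *
          ((zmode Lc (unitS₂ (sfStep Lc j) (smStep d Lc j) (T2RecOf d Lc (GcombSh Lc) (SpureCombOf tabs cE cVH cΛ) tabs.M cE₂ cB Tc tabs.vh₂S tabs.mixFF j)) μ ν (Sum.inl α) (Sum.inl β)
        + zmode Lc (unitS₂ (sfStep Lc j) (smStep d Lc j) (T2RecOf d Lc (GcombSh Lc) (SpureCombOf tabs cE cVH cΛ) tabs.M cE₂ cB Tc tabs.vh₂S tabs.mixFF j)) ν μ (Sum.inl α) (Sum.inl β))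
            - (zmode Lc (fun κ u κ' u' => dressKBmAt (toSite (ctrOff (d + 1) Lc)) Lc (coProjBmAtK (toSite (ctrOff (d + 1) Lc)) Lc (fun κ₁ u₁ => coProjBmAtK (toSite (ctrOff (d + 1) Lc)) Lc (fun κ₂ u₂ => comp (comp (trK (psiKS (ctrOff (d + 1) Lc) Lc)) (slotPsiS (ctrOff (d + 1) Lc) Lc (slotPsiS (ctrOff (d + 1) Lc) Lc (unitS₂ (sfStep Lc j) (smStep d Lc j) (T2RecOf d Lc (GcombSh Lc) (SpureCombOf tabs cE cVH cΛ) tabs.M cE₂ cB Tc tabs.vh₂S tabs.mixFF j)) κ₁ u₁) κ₂ u₂)) (psiKS (ctrOff (d + 1) Lc) Lc)) κ' u') κ u)) μ ν (Sum.inl α) (Sum.inl β)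
        + zmode Lc (fun κ u κ' u' => dressKBmAt (toSite (ctrOff (d + 1) Lc)) Lc (coProjBmAtK (toSite (ctrOff (d + 1) Lc)) Lc (fun κ₁ u₁ => coProjBmAtK (toSite (ctrOff (d + 1) Lc)) Lc (fun κ₂ u₂ => comp (comp (trK (psiKS (ctrOff (d + 1) Lc) Lc)) (slotPsiS (ctrOff (d + 1) Lc) Lc (slotPsiS (ctrOff (d + 1) Lc) Lc (unitS₂ (sfStep Lc j) (smStep d Lc j) (T2RecOf d Lc (GcombSh Lc) (SpureCombOf tabs cE cVH cΛ) tabs.M cE₂ cB Tc tabs.vh₂S tabs.mixFF j)) κ₁ u₁) κ₂ u₂)) (psiKS (ctrOff (d + 1) Lc) Lc)) κ' u') κ u)) ν μ (Sum.inl α) (Sum.inl β))) := by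
  rw [zmodeSym_sourceB_comb_eq tabs cE cVH cΛ cE₂ cB Tc N j μ ν α β, zmodeSym_forcing_eq tabs cE cVH cΛ cE₂ cB Tc hBff hBmm N j α β μ ν]
  ring

end Summit.QuantumFields.BalabanUV.Beta.GAN24.CombT2RecChargeStep

end
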